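import Literature.MathematicalPhysics.QuantumFieldTheory.SliceBottleneck
import Literature.MathematicalPhysics.QuantumFieldTheory.LatticeGaugeProofs
import Literature.MathematicalPhysics.QuantumLattice.YangMillsClassical
import HarnessLib

/-!
# A two-set bottleneck criterion for the weak-coupling slice bottleneck (proved)

Companion to `SliceBottleneck.lean` (the registered open statement `SliceBottleneck` /
`SliceBottleneckAt G r` of the `QuantumFields/YangMills` slice-Poincaré negative lemmas). Everything
here is PROVED; no definition of a `Prop`, no named fact.

**Main result, `sliceBottleneckAt_of_separatedSets`** — the easy direction of Cheeger's inequality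
("a bottleneck bounds the Poincaré constant from below"), written in the exact vocabulary of
`SliceBottleneckAt` (Wilson's measure `μ` on `(ℤ/(2S+1))⁴`, single-link metric slopes as `limsup`s of
difference quotients for the Frobenius link metric `√(Σ_{ab} |ρ(g)_{ab} − ρ(U_ℓ)_{ab}|²)`, the time-zero
spatial Dirichlet form `dir`, the variance): if for cofinally many `β`, all budgets `K ≥ 0` and
cofinally many `S` there are measurable events `A`, `A'` of gauge fields, `A'` gauge invariant,
SEPARATED on the time-zero slice — `sliceDist r U V ≥ δ > 0` for `U ∈ A`, `V ∈ A'` — with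
`K (2S+1)³ · |E| (4/δ)² · μ((A ∪ A')ᶜ) < μ(A) μ(A')` (`|E| = Fintype.card (Edge 4 (2S+1)) = 4(2S+1)⁴`),
then `SliceBottleneckAt G r`. So an inhabitant of `SliceBottleneck` is exactly a family of sector
events plus two measure estimates (for the intended `SO(3)` witness: two 't Hooft flux sectors off the
bad monopole event; a Peierls bound for the complement and light magnetic flux for the sectors — the
latter open, see `SliceBottleneck.lean`, `## Status`).

**Ingredients (all proved).**
* `sliceDist r U V = Σ_{ℓ spatial, t = 0} ‖ρ(U_ℓ) − ρ(V_ℓ)‖_F` — the items' link metric restricted to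
  the time-zero spatial links: a pseudometric, dominated by the full link metric, moved by at most
  `‖ρ(g) − ρ(U_ℓ)‖_F` under a single-link update, invariant under simultaneous gauge transformations
  (unitary invariance of the Frobenius norm, tree `Matrix.frobenius_norm_unitaryGroup_mul` /
  `Matrix.frobenius_norm_mul_unitaryGroup`), continuous.
* `sliceInfDist r A U = inf_{W ∈ A} sliceDist r U W` — `1`-Lipschitz for `sliceDist`, gauge invariant
  for gauge-invariant `A`, a function of the time-zero spatial links, continuous.
* `bottleneckFun r A' δ = min(1, max(0, (4/δ)·sliceInfDist r A' − 1))` — values in `[0, 1]`, `= 0` where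
  `sliceInfDist < δ/4`, `= 1` where `sliceInfDist ≥ δ/2`, `(4/δ)`-Lipschitz, gauge invariant,
  time-zero-local, continuous.
* `limsup_nonneg_and_le` — on `ℝ` a `limsup` of a non-negative function eventually `≤ C` lies in
  `[0, C]` along every filter (covers the junk value along `⊥`); hence the metric slopes of
  `bottleneckFun` lie in `[0, 4/δ]` (`limsup_slope_bottleneckFun_le`) and VANISH off the layer
  `{δ/4 ≤ sliceInfDist ≤ δ/2}`, where the function is locally constant
  (`limsup_slope_bottleneckFun_eq_zero`).
* `measureReal_mul_le_integral_sq_sub` — under a probability measure a `[0, 1]`-valued `f` with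
  `f = 1` on `A`, `f = 0` on `A'` (disjoint measurable) has `∫ (f − ∫ f)² ≥ μ(A) μ(A')`.

Standard material (bottleneck / conductance bounds for spectral gaps; Lipschitz cut-offs of distance
functions); no single source. [folklore]
-/

noncomputable section

open scoped BigOperators Topology Matrix.Norms.Frobenius
open Filter MeasureTheory

namespace Literature.MathematicalPhysics.QuantumFieldTheory

section Criterion

/-- On `ℝ`, a `limsup` of a non-negative function that is eventually `≤ C` (`0 ≤ C`) lies in
`[0, C]` along EVERY filter (along `⊥` it is the junk value `sInf univ = 0`). [folklore] -/
theorem limsup_nonneg_and_le {α : Type*} (F : Filter α) {u : α → ℝ} {C : ℝ} (hC : 0 ≤ C)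
    (h0 : ∀ x, 0 ≤ u x) (hle : ∀ᶠ x in F, u x ≤ C) : 0 ≤ F.limsup u ∧ F.limsup u ≤ C := by
  rw [Filter.limsup_eq]
  rcases F.eq_or_neBot with rfl | hF
  · simp only [Filter.eventually_bot, Set.setOf_true]
    rw [Real.sInf_of_not_bddBelow not_bddBelow_univ]
    exact ⟨le_rfl, hC⟩
  · have hlow : ∀ a ∈ {a : ℝ | ∀ᶠ x in F, u x ≤ a}, 0 ≤ a := fun a ha => by
      obtain ⟨x, hx⟩ := ha.exists
      exact (h0 x).trans hx
    exact ⟨le_csInf ⟨C, hle⟩ hlow, csInf_le ⟨0, hlow⟩ hle⟩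

/-- `√(Σ_{ab} |M_ab|²)` (the `√fro` of the slice-Poincaré route items) is the Frobenius norm. [folklore] -/
theorem sqrt_sum_norm_sq_eq_norm {N : ℕ} (M : Matrix (Fin N) (Fin N) ℂ) :
    Real.sqrt (∑ a, ∑ b, ‖M a b‖ ^ 2) = ‖M‖ := by
  rw [Matrix.frobenius_norm_def, Real.sqrt_eq_rpow]
  simp

variable {G : Type} [Group G] [TopologicalSpace G]

/-- The **time-zero link distance** `d₀(U, V) = Σ_{ℓ spatial, t = 0} ‖ρ(U_ℓ) − ρ(V_ℓ)‖_F` between two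
gauge fields on the torus `(ℤ/(2S+1))⁴`: the route items' link metric restricted to the time-zero
spatial links. [folklore] -/
def sliceDist (r : LatticeRep G) {S : ℕ} (U V : GaugeConfig 4 (2 * S + 1) G) : ℝ :=
  ∑ e : Edge 4 (2 * S + 1), if e.1 0 = 0 ∧ e.2 ≠ 0 then ‖r.ρ (U e) - r.ρ (V e)‖ else 0

/-- `d₀ ≥ 0`. [folklore] -/
theorem sliceDist_nonneg (r : LatticeRep G) {S : ℕ} (U V : GaugeConfig 4 (2 * S + 1) G) :
    0 ≤ sliceDist r U V :=
  Finset.sum_nonneg fun e _ => by split_ifs <;> [exact norm_nonneg _; exact le_rfl]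

/-- `d₀(U, U) = 0`. [folklore] -/
@[simp] theorem sliceDist_self (r : LatticeRep G) {S : ℕ} (U : GaugeConfig 4 (2 * S + 1) G) :
    sliceDist r U U = 0 :=
  Finset.sum_eq_zero fun e _ => by simp

/-- `d₀` is symmetric. [folklore] -/
theorem sliceDist_comm (r : LatticeRep G) {S : ℕ} (U V : GaugeConfig 4 (2 * S + 1) G) :
    sliceDist r U V = sliceDist r V U :=
  Finset.sum_congr rfl fun e _ => by split_ifs <;> [exact norm_sub_rev _ _; rfl]

/-- Triangle inequality for `d₀`. [folklore] -/
theorem sliceDist_triangle (r : LatticeRep G) {S : ℕ} (U V W : GaugeConfig 4 (2 * S + 1) G) :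
    sliceDist r U W ≤ sliceDist r U V + sliceDist r V W := by
  unfold sliceDist
  rw [← Finset.sum_add_distrib]
  refine Finset.sum_le_sum fun e _ => ?_
  split_ifs
  · exact norm_sub_le_norm_sub_add_norm_sub _ _ _
  · simp

/-- `d₀` only sees the time-zero spatial links of its first argument. [folklore] -/
theorem sliceDist_congr_left (r : LatticeRep G) {S : ℕ} {U U' : GaugeConfig 4 (2 * S + 1) G}
    (h : ∀ e : Edge 4 (2 * S + 1), e.1 0 = 0 → e.2 ≠ 0 → U e = U' e) (W : GaugeConfig 4 (2 * S + 1) G) :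
    sliceDist r U W = sliceDist r U' W :=
  Finset.sum_congr rfl fun e _ => by
    split_ifs with he
    · rw [h e he.1 he.2]
    · rfl

/-- `d₀` is dominated by the full link metric `Σ_ℓ √fro(ρ(U_ℓ) − ρ(V_ℓ))` of the route items. [folklore] -/
theorem sliceDist_le_sum_sqrt (r : LatticeRep G) {S : ℕ} (U V : GaugeConfig 4 (2 * S + 1) G) :
    sliceDist r U V ≤ ∑ e : Edge 4 (2 * S + 1),
      Real.sqrt (∑ a, ∑ b, ‖(r.ρ (U e) - r.ρ (V e)) a b‖ ^ 2) := by
  refine Finset.sum_le_sum fun e _ => ?_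
  rw [sqrt_sum_norm_sq_eq_norm]
  split_ifs <;> [exact le_rfl; exact norm_nonneg _]

/-- A single-link update moves `d₀` by at most the link distance `‖ρ(g) − ρ(U_ℓ)‖_F`. [folklore] -/
theorem sliceDist_update_le (r : LatticeRep G) {S : ℕ} (U : GaugeConfig 4 (2 * S + 1) G)
    (e : Edge 4 (2 * S + 1)) (g : G) :
    sliceDist r (Function.update U e g) U ≤ ‖r.ρ g - r.ρ (U e)‖ := by
  classical
  unfold sliceDist
  have hrest : ∀ e' ∈ (Finset.univ : Finset (Edge 4 (2 * S + 1))), e' ≠ e →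
      (if e'.1 0 = 0 ∧ e'.2 ≠ 0 then ‖r.ρ (Function.update U e g e') - r.ρ (U e')‖ else 0) = 0 :=
    fun e' _ hne => by rw [Function.update_of_ne hne]; simp
  rw [Finset.sum_eq_single_of_mem e (Finset.mem_univ e) hrest, Function.update_self]
  split_ifs <;> [exact le_rfl; exact norm_nonneg _]

/-- `d₀` is invariant under simultaneous gauge transformations (unitarity of `ρ`: the Frobenius
norm is invariant under left and right multiplication by unitaries). [folklore] -/
theorem sliceDist_gaugeTransform (r : LatticeRep G) {S : ℕ} (g : Site 4 (2 * S + 1) → G)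
    (U V : GaugeConfig 4 (2 * S + 1) G) :
    sliceDist r (gaugeTransform g U) (gaugeTransform g V) = sliceDist r U V := by
  refine Finset.sum_congr rfl fun e _ => ?_
  split_ifs
  · simp only [gaugeTransform, map_mul]
    rw [← sub_mul, ← mul_sub,
      Matrix.frobenius_norm_mul_unitaryGroup _ ⟨r.ρ (g (e.1.shift e.2))⁻¹, r.mem_unitary _⟩,
      Matrix.frobenius_norm_unitaryGroup_mul ⟨r.ρ (g e.1), r.mem_unitary _⟩]
  · rfl

/-- `d₀(U, ·)` is continuous. [folklore] -/
theorem continuous_sliceDist (r : LatticeRep G) {S : ℕ} (U : GaugeConfig 4 (2 * S + 1) G) :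
    Continuous (sliceDist r U) := by
  refine continuous_finsetSum _ fun e _ => ?_
  split_ifs
  · exact ((continuous_const.sub (r.continuous.comp (continuous_apply e))).norm)
  · exact continuous_const

/-- The **`d₀`-distance to a set** `D_A(U) = inf_{W ∈ A} d₀(U, W)` (`0` for `A = ∅`). [folklore] -/
def sliceInfDist (r : LatticeRep G) {S : ℕ} (A : Set (GaugeConfig 4 (2 * S + 1) G))
    (U : GaugeConfig 4 (2 * S + 1) G) : ℝ :=
  sInf (sliceDist r U '' A)

/-- `D_A ≥ 0`. [folklore] -/
theorem sliceInfDist_nonneg (r : LatticeRep G) {S : ℕ} (A : Set (GaugeConfig 4 (2 * S + 1) G))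
    (U : GaugeConfig 4 (2 * S + 1) G) : 0 ≤ sliceInfDist r A U := by
  refine Real.sInf_nonneg ?_
  rintro _ ⟨W, -, rfl⟩
  exact sliceDist_nonneg r U W

/-- `D_A(U) ≤ d₀(U, W)` for `W ∈ A`. [folklore] -/
theorem sliceInfDist_le (r : LatticeRep G) {S : ℕ} {A : Set (GaugeConfig 4 (2 * S + 1) G)}
    (U : GaugeConfig 4 (2 * S + 1) G) {W : GaugeConfig 4 (2 * S + 1) G} (hW : W ∈ A) :
    sliceInfDist r A U ≤ sliceDist r U W :=
  csInf_le ⟨0, by rintro _ ⟨W', -, rfl⟩; exact sliceDist_nonneg r U W'⟩ ⟨W, hW, rfl⟩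

/-- A uniform lower bound on `d₀(U, W)`, `W ∈ A ≠ ∅`, bounds `D_A(U)` from below. [folklore] -/
theorem le_sliceInfDist (r : LatticeRep G) {S : ℕ} {A : Set (GaugeConfig 4 (2 * S + 1) G)}
    (hA : A.Nonempty) (U : GaugeConfig 4 (2 * S + 1) G) {δ : ℝ} (h : ∀ W ∈ A, δ ≤ sliceDist r U W) :
    δ ≤ sliceInfDist r A U :=
  le_csInf (hA.image _) (by rintro _ ⟨W, hW, rfl⟩; exact h W hW)

/-- `D_A = 0` on `A`. [folklore] -/
theorem sliceInfDist_eq_zero_of_mem (r : LatticeRep G) {S : ℕ} {A : Set (GaugeConfig 4 (2 * S + 1) G)}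
    {U : GaugeConfig 4 (2 * S + 1) G} (hU : U ∈ A) : sliceInfDist r A U = 0 :=
  le_antisymm (by simpa using sliceInfDist_le r U hU) (sliceInfDist_nonneg r A U)

/-- `D_A` is `1`-Lipschitz for `d₀`: `D_A(U) ≤ D_A(V) + d₀(U, V)`. [folklore] -/
theorem sliceInfDist_le_add (r : LatticeRep G) {S : ℕ} {A : Set (GaugeConfig 4 (2 * S + 1) G)}
    (hA : A.Nonempty) (U V : GaugeConfig 4 (2 * S + 1) G) :
    sliceInfDist r A U ≤ sliceInfDist r A V + sliceDist r U V := by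
  rw [← sub_le_iff_le_add]
  refine le_csInf (hA.image _) ?_
  rintro _ ⟨W, hW, rfl⟩
  rw [sub_le_iff_le_add, add_comm]
  exact (sliceInfDist_le r U hW).trans (sliceDist_triangle r U V W)

/-- `|D_A(U) − D_A(V)| ≤ d₀(U, V)`. [folklore] -/
theorem abs_sliceInfDist_sub_le (r : LatticeRep G) {S : ℕ} {A : Set (GaugeConfig 4 (2 * S + 1) G)}
    (hA : A.Nonempty) (U V : GaugeConfig 4 (2 * S + 1) G) :
    |sliceInfDist r A U - sliceInfDist r A V| ≤ sliceDist r U V := by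
  rw [abs_sub_le_iff]
  constructor
  · linarith [sliceInfDist_le_add r hA U V]
  · linarith [sliceInfDist_le_add r hA V U, sliceDist_comm r U V]

/-- `D_A` only sees the time-zero spatial links. [folklore] -/
theorem sliceInfDist_congr (r : LatticeRep G) {S : ℕ} (A : Set (GaugeConfig 4 (2 * S + 1) G))
    {U U' : GaugeConfig 4 (2 * S + 1) G}
    (h : ∀ e : Edge 4 (2 * S + 1), e.1 0 = 0 → e.2 ≠ 0 → U e = U' e) :
    sliceInfDist r A U = sliceInfDist r A U' := by
  unfold sliceInfDist
  congr 1
  exact Set.image_congr fun W _ => sliceDist_congr_left r h W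

/-- `D_A` is gauge invariant when `A` is. [folklore] -/
theorem sliceInfDist_gaugeTransform (r : LatticeRep G) {S : ℕ} {A : Set (GaugeConfig 4 (2 * S + 1) G)}
    (hA : ∀ (g : Site 4 (2 * S + 1) → G) (U : GaugeConfig 4 (2 * S + 1) G), U ∈ A → gaugeTransform g U ∈ A)
    (g : Site 4 (2 * S + 1) → G) (U : GaugeConfig 4 (2 * S + 1) G) :
    sliceInfDist r A (gaugeTransform g U) = sliceInfDist r A U := by
  unfold sliceInfDist
  congr 1
  ext x
  constructor
  · rintro ⟨W, hW, rfl⟩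
    refine ⟨gaugeTransform (fun y => (g y)⁻¹) W, hA _ W hW, ?_⟩
    have : W = gaugeTransform g (gaugeTransform (fun y => (g y)⁻¹) W) := by
      funext e; simp [gaugeTransform, mul_assoc]
    conv_rhs => rw [this]
    exact (sliceDist_gaugeTransform r g U _).symm
  · rintro ⟨W, hW, rfl⟩
    exact ⟨gaugeTransform g W, hA g W hW, sliceDist_gaugeTransform r g U W⟩

/-- `D_A` is continuous (`A ≠ ∅`). [folklore] -/
theorem continuous_sliceInfDist (r : LatticeRep G) {S : ℕ} {A : Set (GaugeConfig 4 (2 * S + 1) G)}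
    (hA : A.Nonempty) : Continuous (sliceInfDist r A) := by
  refine continuous_iff_continuousAt.2 fun U => ?_
  rw [ContinuousAt, Metric.tendsto_nhds]
  intro ε hε
  have h0 : Tendsto (sliceDist r U) (𝓝 U) (𝓝 0) := by
    simpa using (continuous_sliceDist r U).tendsto U
  filter_upwards [(tendsto_order.1 h0).2 ε hε] with V hV
  rw [Real.dist_eq]
  exact lt_of_le_of_lt ((abs_sliceInfDist_sub_le r hA V U).trans_eq (sliceDist_comm r V U)) hV

/-- The **bottleneck test function** of a set `A'` at scale `δ`:
`f(U) = min(1, max(0, (4/δ) D_{A'}(U) − 1))` — equal to `0` where `D_{A'} ≤ δ/4`, to `1` where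
`D_{A'} ≥ δ/2`, `(4/δ)`-Lipschitz for `d₀`. [folklore] -/
def bottleneckFun (r : LatticeRep G) {S : ℕ} (A' : Set (GaugeConfig 4 (2 * S + 1) G)) (δ : ℝ)
    (U : GaugeConfig 4 (2 * S + 1) G) : ℝ :=
  min 1 (max 0 (4 / δ * sliceInfDist r A' U - 1))

/-- `0 ≤ f ≤ 1`. [folklore] -/
theorem bottleneckFun_mem_Icc (r : LatticeRep G) {S : ℕ} (A' : Set (GaugeConfig 4 (2 * S + 1) G))
    (δ : ℝ) (U : GaugeConfig 4 (2 * S + 1) G) : bottleneckFun r A' δ U ∈ Set.Icc (0 : ℝ) 1 :=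
  ⟨le_min zero_le_one (le_max_left _ _), min_le_left _ _⟩

/-- `f = 0` where `D_{A'} < δ/4` (`δ > 0`). [folklore] -/
theorem bottleneckFun_eq_zero (r : LatticeRep G) {S : ℕ} {A' : Set (GaugeConfig 4 (2 * S + 1) G)}
    {δ : ℝ} (hδ : 0 < δ) {U : GaugeConfig 4 (2 * S + 1) G} (hU : sliceInfDist r A' U < δ / 4) :
    bottleneckFun r A' δ U = 0 := by
  unfold bottleneckFun
  have h1 : 4 / δ * sliceInfDist r A' U - 1 ≤ 0 := by
    rw [sub_nonpos, div_mul_eq_mul_div, div_le_one hδ]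
    linarith
  rw [max_eq_left h1, min_eq_right zero_le_one]

/-- `f = 1` where `δ/2 ≤ D_{A'}` (`δ > 0`). [folklore] -/
theorem bottleneckFun_eq_one (r : LatticeRep G) {S : ℕ} {A' : Set (GaugeConfig 4 (2 * S + 1) G)}
    {δ : ℝ} (hδ : 0 < δ) {U : GaugeConfig 4 (2 * S + 1) G} (hU : δ / 2 ≤ sliceInfDist r A' U) :
    bottleneckFun r A' δ U = 1 := by
  unfold bottleneckFun
  have h1 : 1 ≤ 4 / δ * sliceInfDist r A' U - 1 := by
    rw [le_sub_iff_add_le, div_mul_eq_mul_div, le_div_iff₀ hδ]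
    linarith
  rw [min_eq_left]
  exact h1.trans (le_max_right _ _)

/-- `f` is `(4/δ)`-Lipschitz for `d₀` (`δ > 0`, `A' ≠ ∅`). [folklore] -/
theorem abs_bottleneckFun_sub_le (r : LatticeRep G) {S : ℕ} {A' : Set (GaugeConfig 4 (2 * S + 1) G)}
    (hA' : A'.Nonempty) {δ : ℝ} (hδ : 0 < δ) (U V : GaugeConfig 4 (2 * S + 1) G) :
    |bottleneckFun r A' δ U - bottleneckFun r A' δ V| ≤ 4 / δ * sliceDist r U V := by
  have h := abs_sliceInfDist_sub_le r hA' U V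
  have hmin : ∀ x y : ℝ, |min 1 x - min 1 y| ≤ |x - y| := fun x y => abs_min_sub_min_le_max _ _ _ _ |>.trans
    (by simp)
  have hmax : ∀ x y : ℝ, |max 0 x - max 0 y| ≤ |x - y| := fun x y => abs_max_sub_max_le_max _ _ _ _ |>.trans
    (by simp)
  unfold bottleneckFun
  refine (hmin _ _).trans ((hmax _ _).trans ?_)
  rw [show 4 / δ * sliceInfDist r A' U - 1 - (4 / δ * sliceInfDist r A' V - 1) =
    4 / δ * (sliceInfDist r A' U - sliceInfDist r A' V) by ring, abs_mul,
    abs_of_pos (div_pos four_pos hδ)]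
  exact mul_le_mul_of_nonneg_left h (div_pos four_pos hδ).le

/-- `f` is gauge invariant when `A'` is. [folklore] -/
theorem isGaugeInvariant_bottleneckFun (r : LatticeRep G) {S : ℕ} {A' : Set (GaugeConfig 4 (2 * S + 1) G)}
    (hA' : ∀ (g : Site 4 (2 * S + 1) → G) (U : GaugeConfig 4 (2 * S + 1) G), U ∈ A' → gaugeTransform g U ∈ A')
    (δ : ℝ) : IsGaugeInvariant (bottleneckFun r A' δ) := fun g U => by
  unfold bottleneckFun
  rw [sliceInfDist_gaugeTransform r hA']

/-- `f` is a function of the time-zero spatial links. [folklore] -/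
theorem bottleneckFun_congr (r : LatticeRep G) {S : ℕ} (A' : Set (GaugeConfig 4 (2 * S + 1) G)) (δ : ℝ)
    {U U' : GaugeConfig 4 (2 * S + 1) G}
    (h : ∀ e : Edge 4 (2 * S + 1), e.1 0 = 0 → e.2 ≠ 0 → U e = U' e) :
    bottleneckFun r A' δ U = bottleneckFun r A' δ U' := by
  unfold bottleneckFun
  rw [sliceInfDist_congr r A' h]

/-- `f` is continuous (`A' ≠ ∅`). [folklore] -/
theorem continuous_bottleneckFun (r : LatticeRep G) {S : ℕ} {A' : Set (GaugeConfig 4 (2 * S + 1) G)}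
    (hA' : A'.Nonempty) (δ : ℝ) : Continuous (bottleneckFun r A' δ) :=
  continuous_const.min (continuous_const.max
    ((continuous_const.mul (continuous_sliceInfDist r hA')).sub continuous_const))

/-- **The metric slope of `f` is at most `4/δ`** (and non-negative) at every configuration and link:
the route items' `slope f U ℓ = limsup_{g → U_ℓ, g ≠ U_ℓ} |f(U[ℓ ↦ g]) − f(U)| / ‖ρ(g) − ρ(U_ℓ)‖_F`. [folklore] -/
theorem limsup_slope_bottleneckFun_le (r : LatticeRep G) {S : ℕ} {A' : Set (GaugeConfig 4 (2 * S + 1) G)}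
    (hA' : A'.Nonempty) {δ : ℝ} (hδ : 0 < δ) (U : GaugeConfig 4 (2 * S + 1) G) (e : Edge 4 (2 * S + 1)) :
    0 ≤ Filter.limsup (fun g : G => |bottleneckFun r A' δ (Function.update U e g) - bottleneckFun r A' δ U| /
        Real.sqrt (∑ a, ∑ b, ‖(r.ρ g - r.ρ (U e)) a b‖ ^ 2)) (𝓝[≠] (U e)) ∧
    Filter.limsup (fun g : G => |bottleneckFun r A' δ (Function.update U e g) - bottleneckFun r A' δ U| /
        Real.sqrt (∑ a, ∑ b, ‖(r.ρ g - r.ρ (U e)) a b‖ ^ 2)) (𝓝[≠] (U e)) ≤ 4 / δ := by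
  refine limsup_nonneg_and_le _ (div_pos four_pos hδ).le
    (fun g => div_nonneg (abs_nonneg _) (Real.sqrt_nonneg _)) (Eventually.of_forall fun g => ?_)
  rw [sqrt_sum_norm_sq_eq_norm]
  rcases (norm_nonneg (r.ρ g - r.ρ (U e))).eq_or_lt with h0 | hpos
  · rw [← h0, div_zero]; exact (div_pos four_pos hδ).le
  · rw [div_le_iff₀ hpos]
    exact (abs_bottleneckFun_sub_le r hA' hδ _ _).trans
      (mul_le_mul_of_nonneg_left (sliceDist_update_le r U e g) (div_pos four_pos hδ).le)

/-- **The metric slope of `f` vanishes off the transition layer `{δ/4 ≤ D_{A'} ≤ δ/2}`**: there `f` is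
locally constant (`D_{A'}` is continuous), so the difference quotients vanish near `U_ℓ`. [folklore] -/
theorem limsup_slope_bottleneckFun_eq_zero (r : LatticeRep G) {S : ℕ} {A' : Set (GaugeConfig 4 (2 * S + 1) G)}
    (hA' : A'.Nonempty) {δ : ℝ} (hδ : 0 < δ) {U : GaugeConfig 4 (2 * S + 1) G}
    (hU : sliceInfDist r A' U < δ / 4 ∨ δ / 2 < sliceInfDist r A' U) (e : Edge 4 (2 * S + 1)) :
    Filter.limsup (fun g : G => |bottleneckFun r A' δ (Function.update U e g) - bottleneckFun r A' δ U| /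
        Real.sqrt (∑ a, ∑ b, ‖(r.ρ g - r.ρ (U e)) a b‖ ^ 2)) (𝓝[≠] (U e)) = 0 := by
  classical
  have hcont : Continuous fun g : G => sliceInfDist r A' (Function.update U e g) :=
    (continuous_sliceInfDist r hA').comp (continuous_const.update e continuous_id)
  have htend : Tendsto (fun g : G => sliceInfDist r A' (Function.update U e g)) (𝓝 (U e))
      (𝓝 (sliceInfDist r A' U)) := by
    simpa using hcont.tendsto (U e)
  have hev : ∀ᶠ g in 𝓝[≠] (U e),
      bottleneckFun r A' δ (Function.update U e g) = bottleneckFun r A' δ U := by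
    refine Eventually.filter_mono nhdsWithin_le_nhds ?_
    rcases hU with hU | hU
    · filter_upwards [htend.eventually_lt_const hU] with g hg
      rw [bottleneckFun_eq_zero r hδ hg, bottleneckFun_eq_zero r hδ hU]
    · filter_upwards [htend.eventually_const_lt hU] with g hg
      rw [bottleneckFun_eq_one r hδ hg.le, bottleneckFun_eq_one r hδ hU.le]
  have hle : ∀ᶠ g in 𝓝[≠] (U e), |bottleneckFun r A' δ (Function.update U e g) - bottleneckFun r A' δ U| /
      Real.sqrt (∑ a, ∑ b, ‖(r.ρ g - r.ρ (U e)) a b‖ ^ 2) ≤ 0 :=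
    hev.mono fun g hg => by rw [hg, sub_self, abs_zero, zero_div]
  have h := limsup_nonneg_and_le (𝓝[≠] (U e)) le_rfl
    (fun g => div_nonneg (abs_nonneg _) (Real.sqrt_nonneg _)) hle
  exact le_antisymm h.2 h.1

/-- **Variance across a bottleneck.** Under a probability measure, a `[0, 1]`-valued `f` equal to `1`
on `A` and to `0` on `A'` (disjoint measurable events) has `Var f ≥ μ(A) μ(A')`:
`∫ (f − m)² ≥ (1 − m)² μ(A) + m² μ(A') ≥ μ(A) μ(A')` as `μ(A) + μ(A') ≤ 1`. [folklore] -/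
theorem measureReal_mul_le_integral_sq_sub {X : Type*} [MeasurableSpace X] (μ : Measure X)
    [IsProbabilityMeasure μ] {f : X → ℝ} (hf : AEStronglyMeasurable f μ)
    (h01 : ∀ x, f x ∈ Set.Icc (0 : ℝ) 1) {A A' : Set X} (hA : MeasurableSet A) (hA' : MeasurableSet A')
    (hdisj : Disjoint A A') (h1 : ∀ x ∈ A, f x = 1) (h0 : ∀ x ∈ A', f x = 0) :
    μ.real A * μ.real A' ≤ ∫ x, (f x - ∫ y, f y ∂μ) ^ 2 ∂μ := by
  set m := ∫ y, f y ∂μ with hm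
  have hint : Integrable (fun x => (f x - m) ^ 2) μ := by
    refine Integrable.mono' (integrable_const ((1 + |m|) ^ 2)) ((hf.sub aestronglyMeasurable_const).pow 2)
      (ae_of_all _ fun x => ?_)
    rw [Real.norm_eq_abs, abs_pow]
    refine pow_le_pow_left₀ (abs_nonneg _) ((abs_sub _ _).trans (add_le_add ?_ le_rfl)) 2
    rw [abs_of_nonneg (h01 x).1]
    exact (h01 x).2
  have hsum : μ.real A + μ.real A' ≤ 1 := by
    rw [← measureReal_union hdisj hA']
    exact measureReal_le_one
  have hpt : ∀ x, (1 - m) ^ 2 * A.indicator 1 x + m ^ 2 * A'.indicator 1 x ≤ (f x - m) ^ 2 := by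
    intro x
    by_cases hxA : x ∈ A
    · have hxA' : x ∉ A' := Set.disjoint_left.1 hdisj hxA
      simp [Set.indicator, hxA, hxA', h1 x hxA]
    · by_cases hxA' : x ∈ A'
      · simp [Set.indicator, hxA, hxA', h0 x hxA']
      · simp only [Set.indicator, hxA, hxA', if_false, mul_zero, add_zero]
        positivity
  have hiA : Integrable (fun x => (1 - m) ^ 2 * A.indicator (1 : X → ℝ) x) μ :=
    ((integrable_const (1 : ℝ)).indicator hA).const_mul _
  have hiA' : Integrable (fun x => m ^ 2 * A'.indicator (1 : X → ℝ) x) μ :=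
    ((integrable_const (1 : ℝ)).indicator hA').const_mul _
  have ha := measureReal_nonneg (μ := μ) (s := A)
  have ha' := measureReal_nonneg (μ := μ) (s := A')
  calc μ.real A * μ.real A' ≤ (1 - m) ^ 2 * μ.real A + m ^ 2 * μ.real A' := by
        nlinarith [mul_nonneg (add_nonneg (mul_nonneg (sq_nonneg (1 - m)) ha) (mul_nonneg (sq_nonneg m) ha'))
          (sub_nonneg.2 hsum), sq_nonneg ((1 - m) * μ.real A - m * μ.real A')]
    _ = ∫ x, ((1 - m) ^ 2 * A.indicator 1 x + m ^ 2 * A'.indicator 1 x) ∂μ := by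
        rw [integral_add hiA hiA', integral_const_mul, integral_const_mul, integral_indicator_one hA,
          integral_indicator_one hA']
    _ ≤ ∫ x, (f x - m) ^ 2 ∂μ := integral_mono (hiA.add hiA') hint hpt

/-- **Two-set bottleneck criterion for the slice bottleneck** (the easy direction of Cheeger's
inequality, in the vocabulary of `SliceBottleneckAt`). Suppose that for cofinally many `β`, every
budget `K ≥ 0` and cofinally many `S` the torus `(ℤ/(2S+1))⁴` carries two measurable events `A`, `A'`
of gauge fields, `A'` gauge invariant, SEPARATED on the time-zero slice — `d₀(U, V) ≥ δ > 0` for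
`U ∈ A`, `V ∈ A'` — whose Wilson masses beat the mass of the complement by the volume factor:
`K (2S+1)³ · |E| (4/δ)² · μ((A ∪ A')ᶜ) < μ(A) μ(A')`, `|E| = 4(2S+1)⁴` the number of links. Then
`SliceBottleneckAt G r`: the test function is `f = min(1, max(0, (4/δ) D_{A'} − 1))`, gauge invariant,
time-zero-local, `(4/δ)`-link-Lipschitz, `= 1` on `A`, `= 0` on `A'`, with metric slopes `≤ 4/δ`
supported in `(A ∪ A')ᶜ`, so `dir f ≤ |E| (4/δ)² μ((A ∪ A')ᶜ)` while `Var f ≥ μ(A) μ(A')`. This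
isolates what an inhabitant of `SliceBottleneck` needs: the sets and the two measure estimates (for the
intended `SO(3)` witness, `A`, `A'` = two 't Hooft flux sectors off the bad monopole event, whose
Wilson masses at fixed weak coupling on large tori are the open input). [folklore] -/
theorem sliceBottleneckAt_of_separatedSets [IsTopologicalGroup G] [CompactSpace G] [MeasurableSpace G]
    [BorelSpace G] (r : LatticeRep G)
    (h : ∀ β₀ : ℝ, ∃ β : ℝ, β₀ ≤ β ∧ ∀ K : ℝ, 0 ≤ K → ∀ S₀ : ℕ, ∃ S : ℕ, S₀ ≤ S ∧
      ∃ (A A' : Set (GaugeConfig 4 (2 * S + 1) G)) (δ : ℝ), 0 < δ ∧ MeasurableSet A ∧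
        MeasurableSet A' ∧
        (∀ (g : Site 4 (2 * S + 1) → G) (U : GaugeConfig 4 (2 * S + 1) G),
          U ∈ A' → gaugeTransform g U ∈ A') ∧
        (∀ U ∈ A, ∀ V ∈ A', δ ≤ sliceDist r U V) ∧
        K * (2 * S + 1 : ℝ) ^ 3 * ((Fintype.card (Edge 4 (2 * S + 1)) : ℝ) * (4 / δ) ^ 2 *
            (wilsonMeasure (d := 4) (L := 2 * S + 1) r.ρ β).real (A ∪ A')ᶜ) <
          (wilsonMeasure (d := 4) (L := 2 * S + 1) r.ρ β).real A *
            (wilsonMeasure (d := 4) (L := 2 * S + 1) r.ρ β).real A') :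
    SliceBottleneckAt G r := by
  classical
  intro β₀
  obtain ⟨β, hβ, hK⟩ := h β₀
  refine ⟨β, hβ, fun K S₀ => ?_⟩
  obtain ⟨S, hS, A, A', δ, hδ, hA, hA', hinv, hsep, hlt⟩ := hK (max K 0) (le_max_right _ _) S₀
  refine ⟨S, hS, ?_⟩
  dsimp only
  set μ := wilsonMeasure (d := 4) (L := 2 * S + 1) r.ρ β with hμ
  haveI := isProbabilityMeasure_wilsonMeasure (d := 4) (L := 2 * S + 1) (G := G) r.ρ r.continuous β
  haveI := (r.continuous.isClosedEmbedding r.injective).isEmbedding.secondCountableTopology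
  have h4δ : 0 ≤ 4 / δ := (div_pos four_pos hδ).le
  have hprod : 0 < μ.real A * μ.real A' := lt_of_le_of_lt (by positivity) hlt
  have hA'ne : A'.Nonempty := by
    refine nonempty_of_measure_ne_zero (μ := μ) fun h0 => ?_
    have : μ.real A' = 0 := by simp [measureReal_def, h0]
    rw [this, mul_zero] at hprod
    exact lt_irrefl _ hprod
  have hdisj : Disjoint A A' := by
    refine Set.disjoint_left.2 fun U hUA hUA' => ?_
    have := hsep U hUA U hUA'
    rw [sliceDist_self] at this
    exact absurd this (not_le.2 hδ)
  -- where the slope vanishes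
  have hoff : ∀ U ∈ A ∪ A', sliceInfDist r A' U < δ / 4 ∨ δ / 2 < sliceInfDist r A' U := by
    rintro U (hU | hU)
    · exact Or.inr (lt_of_lt_of_le (by linarith) (le_sliceInfDist r hA'ne U (hsep U hU)))
    · exact Or.inl (by rw [sliceInfDist_eq_zero_of_mem r hU]; positivity)
  refine ⟨bottleneckFun r A' δ, isGaugeInvariant_bottleneckFun r hinv δ,
    fun U V hUV => bottleneckFun_congr r A' δ hUV,
    ⟨4 / δ, fun U V => (abs_bottleneckFun_sub_le r hA'ne hδ U V).trans
      (mul_le_mul_of_nonneg_left (sliceDist_le_sum_sqrt r U V) h4δ)⟩, ?_⟩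
  -- the Dirichlet form is small
  have hterm : ∀ e : Edge 4 (2 * S + 1),
      (if e.1 0 = 0 ∧ e.2 ≠ 0 then ∫ U, (Filter.limsup (fun g : G =>
          |bottleneckFun r A' δ (Function.update U e g) - bottleneckFun r A' δ U| /
            Real.sqrt (∑ a, ∑ b, ‖(r.ρ g - r.ρ (U e)) a b‖ ^ 2)) (𝓝[≠] (U e))) ^ 2 ∂μ else 0) ≤
        (4 / δ) ^ 2 * μ.real (A ∪ A')ᶜ := by
    intro e
    split_ifs
    · have hi : Integrable (fun U => (4 / δ) ^ 2 *
          (A ∪ A')ᶜ.indicator (1 : GaugeConfig 4 (2 * S + 1) G → ℝ) U) μ :=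
        ((integrable_const (1 : ℝ)).indicator (hA.union hA').compl).const_mul _
      rw [← integral_indicator_one (hA.union hA').compl, ← integral_const_mul]
      refine integral_mono_of_nonneg (ae_of_all _ fun U => sq_nonneg _) hi (ae_of_all _ fun U => ?_)
      dsimp only
      by_cases hU : U ∈ A ∪ A'
      · have : U ∉ (A ∪ A')ᶜ := fun h => h hU
        rw [limsup_slope_bottleneckFun_eq_zero r hA'ne hδ (hoff U hU) e, Set.indicator_of_notMem this]
        norm_num
      · have hmem : U ∈ (A ∪ A')ᶜ := hU
        simp only [Set.indicator, hmem, if_true, Pi.one_apply, mul_one]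
        have h := limsup_slope_bottleneckFun_le r hA'ne hδ U e
        exact pow_le_pow_left₀ h.1 h.2 2
    · positivity
  have hdir : (∑ e : Edge 4 (2 * S + 1),
      (if e.1 0 = 0 ∧ e.2 ≠ 0 then ∫ U, (Filter.limsup (fun g : G =>
          |bottleneckFun r A' δ (Function.update U e g) - bottleneckFun r A' δ U| /
            Real.sqrt (∑ a, ∑ b, ‖(r.ρ g - r.ρ (U e)) a b‖ ^ 2)) (𝓝[≠] (U e))) ^ 2 ∂μ else 0)) ≤
        (Fintype.card (Edge 4 (2 * S + 1)) : ℝ) * (4 / δ) ^ 2 * μ.real (A ∪ A')ᶜ := by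
    refine (Finset.sum_le_card_nsmul _ _ _ fun e _ => hterm e).trans ?_
    rw [Finset.card_univ, nsmul_eq_mul, mul_assoc]
  have hdir0 : 0 ≤ ∑ e : Edge 4 (2 * S + 1),
      (if e.1 0 = 0 ∧ e.2 ≠ 0 then ∫ U, (Filter.limsup (fun g : G =>
          |bottleneckFun r A' δ (Function.update U e g) - bottleneckFun r A' δ U| /
            Real.sqrt (∑ a, ∑ b, ‖(r.ρ g - r.ρ (U e)) a b‖ ^ 2)) (𝓝[≠] (U e))) ^ 2 ∂μ else 0) := by
    refine Finset.sum_nonneg fun e _ => ?_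
    split_ifs
    · exact integral_nonneg fun U => sq_nonneg _
    · exact le_rfl
  -- the variance is large
  have hvar : μ.real A * μ.real A' ≤
      ∫ U, (bottleneckFun r A' δ U - ∫ V, bottleneckFun r A' δ V ∂μ) ^ 2 ∂μ :=
    measureReal_mul_le_integral_sq_sub μ (continuous_bottleneckFun r hA'ne δ).aestronglyMeasurable
      (bottleneckFun_mem_Icc r A' δ) hA hA' hdisj
      (fun U hU => bottleneckFun_eq_one r hδ
        ((by linarith : δ / 2 ≤ δ).trans (le_sliceInfDist r hA'ne U (hsep U hU))))
      (fun U hU => bottleneckFun_eq_zero r hδ (by rw [sliceInfDist_eq_zero_of_mem r hU]; positivity))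
  have hL : (0 : ℝ) ≤ (2 * S + 1 : ℝ) ^ 3 := by positivity
  have h1 : K * (2 * S + 1 : ℝ) ^ 3 * (∑ e : Edge 4 (2 * S + 1),
      (if e.1 0 = 0 ∧ e.2 ≠ 0 then ∫ U, (Filter.limsup (fun g : G =>
          |bottleneckFun r A' δ (Function.update U e g) - bottleneckFun r A' δ U| /
            Real.sqrt (∑ a, ∑ b, ‖(r.ρ g - r.ρ (U e)) a b‖ ^ 2)) (𝓝[≠] (U e))) ^ 2 ∂μ else 0)) ≤
      max K 0 * (2 * S + 1 : ℝ) ^ 3 * ((Fintype.card (Edge 4 (2 * S + 1)) : ℝ) * (4 / δ) ^ 2 *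
        μ.real (A ∪ A')ᶜ) :=
    (mul_le_mul_of_nonneg_right (mul_le_mul_of_nonneg_right (le_max_left K 0) hL) hdir0).trans
      (mul_le_mul_of_nonneg_left hdir (mul_nonneg (le_max_right K 0) hL))
  linarith

end Criterion

end Literature.MathematicalPhysics.QuantumFieldTheory

end
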